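import Summits.FinalStateConjecture.FinalStateConjecture.Theses.BartnikGapSettling
import Summits.FinalStateConjecture.FinalStateConjecture.Theorems.BartnikGapSettlingSettledCaptureCrushDefs
import Summits.FinalStateConjecture.FinalStateConjecture.Theorems.BartnikGapSettlingSettledCaptureStubKerrCrushCertificate
import Summits.FinalStateConjecture.FinalStateConjecture.Theorems.BartnikGapSettlingSettledCaptureStubCrushTransport
import Summits.FinalStateConjecture.FinalStateConjecture.Theorems.BartnikGapSettlingSettledCaptureStubVisibleRaysStay
import Summits.FinalStateConjecture.FinalStateConjecture.Theorems.BartnikGapSettlingSettledCaptureExitOfWeightedConcave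
import Summits.FinalStateConjecture.FinalStateConjecture.Theorems.SettledCapture.Negative.SoundRetype
import Literature.Geometry.Lorentzian.CoordScalarCurvatureEvolution

/-!
# Line `null-concave-crush` — skeleton for crux `SettledCapture` (stmt-FinalStateConjecture-17328) of route
`BartnikGapSettling` — file `Cruxes/SettledCapture/Lines/null_concave_crush.lean` (the gate renames `-` to `_` in Lean module names)
(planner-cruxplan-stmt-FinalStateConjecture-17328-null-concave-crush-0, 2026-08-17; idea card
`Cruxes/SettledCapture/Ideas/null-concave-crush.md`, triage r1 k1/k2/k3: pass, with sharpenings answered below)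

## The cut

`SettledCapture ⇐ stub_leavesAreSound + stub_soundExteriorCaptureWithInteriorCharts` (rev 6: stubs 2 `stub_kerrCrushCertificate`
and 3 `stub_crushTransport` are LANDED and discharged inside the composition; rev 1 had the typed
`stub_exteriorCaptureWithInteriorCharts` in place of the first two — see the reshape log below) (+ the two LANDED leaf-free lemmas `stub_visibleRaysStay` p149576 and the
Riccati core `false_of_pos_of_deriv_neg_of_weightedConcave` of `exit_of_weightedConcave` p153671, used inside
the composition).

* `stub_exteriorCaptureWithInteriorCharts` (XL; the ONE leaf-consuming, existential stub — triage r1 "make the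
  certificate EXISTENTIAL after exterior capture"): the crux hypotheses verbatim ⇒ `∃ O d`, the four exterior
  clauses (sub-extremal holes, `O = exteriorOf 𝒟 d.charted`, `HasExhaustiveCharts d`, `IsFutureOriented d`) AND an
  INTERIOR EXPORT: per hole `i` a horizon-penetrating boosted ingoing-Kerr–Schild chart `Φ i` on `{r > r₋(Mᵢ,aᵢ)}`
  which, for every depth `δ > 0` and tolerance `η > 0`, is eventually (chart time `t* > T`) a smooth future-oriented
  open embedding `C¹`-close within `η` to Kerr `(Mᵢ, aᵢ)` on the late shell `{t* > T, r₋ + δ/2 < r < r₊}` (the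
  red-shift + no-shift regions of Dafermos–Luk arXiv:1710.01722; the Cauchy horizon `CH⁺` sits at `t* = +∞` in
  ingoing coordinates and is never charted), together with the RAY CENSUS: every future-complete normalised null ray
  from `Σ` is either cofinally visible (`closure d.charted` beyond every parameter) or, for some hole `i` and depth
  `δ > 0`, eventually inside `Φ i '' {t* > T, r₋ + δ < r < r₊ − δ}` for every `T` (pockets, early interiors and the
  `CH⁺` collar — blue-shift incompleteness — are this stub's burden, as the panel asked: "pockets → tendril-swarm-rays",
  "collar crossing by blue-shift").
* `stub_kerrCrushCertificate` (L; exact Kerr, the card's kit-certified lever j023930 / triage re-derivations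
  `sup ρ = 2a²/r₊²` near `r₊`, reparametrised `G(h)` for all `|a| < M`): for every sub-extremal `(M, a)` and `δ > 0`
  there are a `C²` radial profile `F`, a weight `ρ < 1` and a margin `m > 0` such that `f = F ∘ r` is a WEIGHTED
  NULL-CONCAVE CRUSH FUNCTION WITH MARGIN on the Kerr–Schild shell `{r₋ + δ ≤ r ≤ r₊ − δ}`: for `g_{M,a}`-null `w`,
  `df(w) ≤ −m‖w‖` when `w` is future-directed, and `f · Hess_{g_{M,a}} f (w, w) − ρ · df(w)² ≤ −m‖w‖²`
  (`MetricCoord.hessAt`, the tree's coordinate Hessian; `a = 0`: `r̈ = (r − 3M)L²/r⁴ ≤ 0` inside the hole).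
* `stub_crushTransport` (L; the card's `C¹`-OPENNESS, "provable now" modulo chart calculus): a certificate with margin
  survives in every chart `Φ` that is `C¹`-close within some `η(M, a, δ, ρ, m, F, Λ) > 0`: along every normalised null
  ray of `𝒟` whose parameter tail lies in `Φ '' {t* > T, r₋ + δ < r < r₊ − δ}`, `h = F(r̃)` is positive, `C²`,
  strictly decreasing and weighted-concave `h h'' ≤ ρ h'²` (no margin left, none needed).
* Composition `SettledCapture_of` (kernel-checked, no `sorry` of its own): exterior clauses from stub 1; for
  `RaysStayInClosure` take a complete ray and `t ≥ 0`; census case 1 ⇒ `stub_visibleRaysStay` (landed); census case 2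
  ⇒ certificate (stub 2) ⇒ threshold `η` (stub 3) ⇒ lateness `T` (stub 1 export) ⇒ tail `t₀` (census) ⇒ `h` (stub 3) ⇒
  `False` by the landed Riccati core (`y = h/h'` gains `(1 − ρ)` per unit parameter).

## Honest status on the TYPED crux (triage panel note 1, PICKED.md c1, Lines/birth-dead.md §2)

Stub 1 consumes the crux's typed leaf block, which is IDLE (THE DODGE, kernel anchors p122244/p122576/p122817/p123910,
`leafHyp_minkowski` p146299); its conclusion contains `QuietWindowCapture.Capture`'s, so AS TYPED it inherits the item
verdict `misstated` exactly like birth's `stub_exteriorCaptureWithVisibleRays`. It is nevertheless the faithful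
existential cut, and it is the ONLY place the leaf block enters: under the planners' re-typing over
`CauchyDevelopment.IsSoundNearKerrLeaf` (`Theorems/SettledCapture/Negative/SoundRetype.lean`, `SoundSettledCapture`,
p153807) stub 1's hypothesis block is swapped and NOTHING ELSE in this file changes — stubs 2, 3, the definitions and
the composition are leaf-free and typing-independent (they never mention leaves, `IsMaximal` or `𝓘⁺`).

Disproof used: none exists for this crux (no `Cruxes/SettledCapture/Disproof.lean`, payload path absent, 2026-08-17);
checked against the landed Negative lemmas `TypedNormalForm.lean` (the Minkowski column: `N = 0`, census case 2 is
vacuous there, case 1 holds by `t2Conclusion_minkowski`) and `InheritsCapture.lean` (containment, acknowledged above).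
Model case of stubs 2+3+core: `Literature.Geometry.Lorentzian.Kerr.KerrBlackHoleNoCompleteNullRay_holds` (exact Kerr,
Carter route, all `|a| < M`) — cited, not re-derived; the line's delta is the `C¹`-open certificate.

## Reshape log (lead prover-line-stmt-FinalStateConjecture-17328-a1-0)

* r2 (2026-08-17): the four coordinate-level definitions (`interiorBackground`, `lateShell`,
  `KerrCrushCertificate`, `IsGoodInteriorChart`) moved VERBATIM to
  `Theorems/BartnikGapSettlingSettledCaptureCrushDefs.lean` (p161379, ACCEPTED) and imported here, so that the
  registered stubs can land as `Theorems/` modules; stub texts unchanged byte-for-byte. Stub 2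
  `stub_kerrCrushCertificate` PROVED by the lead (`work/stubs/StubKerrCrushCertificate.lean`, rc 0, axioms
  standard; route: soft shell constants by compactness + stationarity, profile `F(r) = exp(−½ e^{2K(r₁−r)})`,
  weight `½`) — landing as `Theorems/BartnikGapSettlingSettledCaptureStubKerrCrushCertificate.lean`.
* r3 (2026-08-17): wave-1 worker B returned `stub-misstated` on rev-1's typed stub 1
  `stub_exteriorCaptureWithInteriorCharts` (idle typed leaf block; corrected signature = the SOUND form). The cut
  is now FOUR stubs: `stub_leavesAreSound` (typed ⇒ sound leaves: the item's misstatement isolated, dead as typed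
  by design, text shared with line `tendril-swarm-rays`) + `stub_soundExteriorCaptureWithInteriorCharts` (the
  corrected stub 1) + stubs 2, 3 unchanged; `SettledCapture_of` = `settledCapture_iff` ∘ `SoundSettledCapture_of`
  ∘ `stub_leavesAreSound`. Under the planners' re-type the first binder drops and nothing else changes.
* r4 (2026-08-17): stub 2 `stub_kerrCrushCertificate` LANDED (p162630; shell constants p162311; vocabulary p161379)
  and discharged here by the landed theorem — open stubs: `stub_leavesAreSound` (dead by design),
  `stub_soundExteriorCaptureWithInteriorCharts` (XL, open), `stub_crushTransport` (L, in progress).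
* r5 (2026-08-17): stub 3 split at the skeleton level into 3a `stub_chartNullGeodesic` (manifold plumbing) + 3b
  `stub_boostedCertificateStable` (coordinate perturbation), glued by a sorry-free `crushTransport_of`.
* r6 (2026-08-17): 3b LANDED (p164592, wave-2 worker C), 3a LANDED (p164700, lead; bricks `stub_crushChartImmersion`
  p163830, `stub_crushChartGeodesicLift` p164255), and the whole stub 3 `stub_crushTransport` LANDED (p164946, the glue as
  a tree theorem). THE LINE'S MECHANISM (stubs 2, 3) IS NOW ENTIRELY IN `Theorems/`. Open stubs: `stub_leavesAreSound`
  (dead as typed by design = the item's misstatement) and `stub_soundExteriorCaptureWithInteriorCharts` (XL, the open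
  exterior final-state problem fed by SOUND leaves + Dafermos–Luk interior export + ray census). `SoundSettledCapture_of`
  now takes stub 1 alone: the re-typed crux follows from `stub_soundExteriorCaptureWithInteriorCharts` by kernel-checked
  composition with landed theorems only.
-/

set_option linter.dupNamespace false

noncomputable section

namespace Summit.FinalStateConjecture.FinalStateConjecture.Cruxes.SettledCapture.NullConcaveCrush

open Set Filter Function TopologicalSpace
open scoped Manifold ContDiff Topology ENNReal
open Literature.Geometry.Lorentzian
open Summit.FinalStateConjecture.FinalStateConjecture.Theorems.SettledCapture.Negative (LeafHyp settledCapture_iff)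
open Summit.FinalStateConjecture.FinalStateConjecture.Theorems.SettledCapture.Retype
  (SoundLeafHyp SoundSettledCapture soundSettledCapture_iff)
-- the line's vocabulary (`interiorBackground`, `lateShell`, `KerrCrushCertificate`, `IsGoodInteriorChart`,
-- landed VERBATIM as `Theorems/BartnikGapSettlingSettledCaptureCrushDefs.lean`, p161379) and the two landed
-- leaf-free lemmas `stub_visibleRaysStay` (p149576), `false_of_pos_of_deriv_neg_of_weightedConcave` (p153671)
open Summit.FinalStateConjecture.FinalStateConjecture.Theorems.BartnikGapSettling.SettledCapture

/-! ## Definitions: see `Theorems/BartnikGapSettlingSettledCaptureCrushDefs.lean` (p161379) — the four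
coordinate-level definitions of rev 1 of this skeleton were moved there verbatim (lead a1, reshape r2). -/

/-! ## Statements of the four stubs as named propositions (the skeleton audit reads the hypotheses of
`SettledCapture_of` BY NAME: each head must be a declared stub, whence the `Goal.stub_*` abbreviations). -/

/-- Statement of `stub_leavesAreSound` (THE ISOLATED MISSTATEMENT of the typed item: typed leaves ⇒ sound leaves;
text byte-identical to line `tendril-swarm-rays`' stub of the same name, so one death certificate serves both). -/
def LeavesAreSound : Prop := ∀ (X : Type) [TopologicalSpace X] [ChartedSpace E3 X] [IsManifold (𝓡 3) ((⊤ : ℕ∞) : WithTop ℕ∞) X] [T2Space X] [SecondCountableTopology X] [ConnectedSpace X], ∀ D ∈ admissibleVacuumData X, ∀ 𝒟 : VacuumCauchyDevelopment D, 𝒟.IsMaximal → Summit.FinalStateConjecture.HasCompleteNullInfinity 𝒟.toCauchyDevelopment → LeafHyp 𝒟 → SoundLeafHyp 𝒟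

/-- Statement of `stub_soundExteriorCaptureWithInteriorCharts` (SOUND EXTERIOR CAPTURE WITH INTERIOR CHARTS AND RAY
CENSUS: hypotheses = those of `Theorems.SettledCapture.Retype.SoundSettledCapture` p153807 — the leaf block re-typed
over `CauchyDevelopment.IsSoundNearKerrLeaf` — conclusion = rev-1 stub 1's verbatim; the corrected signature returned
by wave-1 worker B, `stub-misstated`, 2026-08-17T13:0xZ). -/
def SoundExteriorCaptureWithInteriorCharts : Prop := ∀ (X : Type) [TopologicalSpace X] [ChartedSpace E3 X] [IsManifold (𝓡 3) ((⊤ : ℕ∞) : WithTop ℕ∞) X] [T2Space X] [SecondCountableTopology X] [ConnectedSpace X], ∀ D ∈ admissibleVacuumData X, ∀ 𝒟 : VacuumCauchyDevelopment D, 𝒟.IsMaximal → Summit.FinalStateConjecture.HasCompleteNullInfinity 𝒟.toCauchyDevelopment → (∃ (N₀ : ℕ) (m₀ χ : ℝ) (k₁ : ℕ) (ε₁ : ENNReal), 0 < m₀ ∧ χ < 1 ∧ 0 < ε₁ ∧ ∀ (k : ℕ) (ε : ENNReal), 0 < ε → ∀ K : Set 𝒟.carrier, IsCompact K → ∃ (N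 : ℕ) (M a : Fin N → ℝ) (S : Set 𝒟.carrier), N ≤ N₀ ∧ (∀ i, m₀ ≤ M i ∧ M i ≤ m₀⁻¹) ∧ Disjoint S (𝒟.metric.causalPast 𝒟.timeOrientation K) ∧ 𝒟.toCauchyDevelopment.IsSoundNearKerrLeaf k ε N M a S ∧ (k₁ ≤ k → ε ≤ ε₁ → ∀ i, |a i| ≤ χ * M i)) → ∃ (O : Set 𝒟.carrier) (d : FinalStateDecomposition 𝒟.toSpacetime O 2), (∀ i, Kerr.IsSubextremal (d.mass i) (d.spin i)) ∧ O = Summit.FinalStateConjecture.exteriorOf 𝒟.toCauchyDevelopment d.charted ∧ Summit.FinalStateConjecture.HasExhaustiveCharts d ∧ Summit.FinalStateConjecture.IsFutureOriented d ∧ ∃ Φ : ∀ i, (interiorBackground (d.motion i) (d.mass i) (d.spin i) (Kerr.rMinus (d.mass i) (d.spin i))).domain → 𝒟.carrier, (∀ (i : Fin d.N) (δ : ℝ), 0 < δ → ∀ η : ℝ≥0∞, 0 < η → ∃ T : ℝ, IsGoodInteriorChart 𝒟 (d.motion i) (d.mass i) (d.spin i) (Φ i) T (Kerr.rMinus (d.mass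 i) (d.spin i) + δ / 2) (Kerr.rPlus (d.mass i) (d.spin i)) η) ∧ (∀ [𝒟.metric.HasLeviCivita], ∀ (p : X) (γ : ℝ → 𝒟.carrier) (dom : Set ℝ), 𝒟.metric.IsNormalisedNullRayFrom 𝒟.timeOrientation 𝒟.embed 𝒟.normal p γ dom → ¬ BddAbove dom → (∀ t ∈ dom, ∃ t' ∈ dom, t ≤ t' ∧ γ t' ∈ closure d.charted) ∨ ∃ (i : Fin d.N) (δ : ℝ), 0 < δ ∧ ∀ T : ℝ, ∃ t₀ ∈ dom, ∀ t ∈ dom, t₀ ≤ t → γ t ∈ Φ i '' lateShell (interiorBackground (d.motion i) (d.mass i) (d.spin i) (Kerr.rMinus (d.mass i) (d.spin i))) T (Kerr.rMinus (d.mass i) (d.spin i) + δ) (Kerr.rPlus (d.mass i) (d.spin i) - δ))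

/-- Statement of `stub_kerrCrushCertificate` (EXACT-KERR WEIGHTED NULL-CONCAVE CRUSH CERTIFICATE, all `|a| < M`). -/
def KerrCrushCertificateExists : Prop := ∀ (M a δ : ℝ), 0 < M → |a| < M → 0 < δ → ∃ (F : ℝ → ℝ) (ρ m : ℝ), ρ < 1 ∧ 0 < m ∧ KerrCrushCertificate M a (Kerr.rMinus M a + δ) (Kerr.rPlus M a - δ) ρ m F

/-- Statement of `stub_crushTransport` (`C¹`-OPENNESS: the certificate survives in `C¹`-close interior charts). -/
def CrushTransport : Prop := ∀ (M a δ ρ m : ℝ) (F : ℝ → ℝ) (mo : lorentzGroup × E4), 0 < M → |a| < M → 0 < δ → 0 < m → KerrCrushCertificate M a (Kerr.rMinus M a + δ) (Kerr.rPlus M a - δ) ρ m F → ∃ η : ℝ≥0∞, 0 < η ∧ ∀ (X : Type) [TopologicalSpace X] [ChartedSpace E3 X] [IsManifold (𝓡 3) ((⊤ : ℕ∞) : WithTop ℕ∞) X] [T2Space X] [SecondCountableTopology X] [ConnectedSpace X] (D : InitialDataSet (𝓡 3) X) (𝒟 : VacuumCauchyDevelopment D) (Φ : (interiorBackground mo M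 a (Kerr.rMinus M a)).domain → 𝒟.carrier) (T : ℝ), IsGoodInteriorChart 𝒟 mo M a Φ T (Kerr.rMinus M a + δ / 2) (Kerr.rPlus M a) η → ∀ [𝒟.metric.HasLeviCivita], ∀ (p : X) (γ : ℝ → 𝒟.carrier) (dom : Set ℝ), 𝒟.metric.IsNormalisedNullRayFrom 𝒟.timeOrientation 𝒟.embed 𝒟.normal p γ dom → ∀ t₀ ∈ dom, (∀ t ∈ dom, t₀ ≤ t → γ t ∈ Φ '' lateShell (interiorBackground mo M a (Kerr.rMinus M a)) T (Kerr.rMinus M a + δ) (Kerr.rPlus M a - δ)) → ∃ h : ℝ → ℝ, (∀ t ∈ dom, t₀ ≤ t → ∃ x ∈ lateShell (interiorBackground mo M a (Kerr.rMinus M a)) T (Kerr.rMinus M a + δ) (Kerr.rPlus M a - δ), Φ x = γ t ∧ h t = F ((interiorBackground mo M a (Kerr.rMinus M a)).radius x.1)) ∧ (∀ t ∈ dom, t₀ < t → 0 < h t) ∧ (∀ t' ∈ dom, t₀ < t' → ContDiffOn ℝ 2 h (Set.Icc t₀ t')) ∧ ∀ t ∈ dom, t₀ < t → deriv h t < 0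 ∧ h t * deriv (deriv h) t ≤ ρ * deriv h t ^ 2

namespace Goal
/-- Statement of `stub_leavesAreSound`, under the stub's name. -/
abbrev stub_leavesAreSound : Prop := LeavesAreSound
/-- Statement of `stub_soundExteriorCaptureWithInteriorCharts`, under the stub's name. -/
abbrev stub_soundExteriorCaptureWithInteriorCharts : Prop := SoundExteriorCaptureWithInteriorCharts
/-- Statement of `stub_kerrCrushCertificate`, under the stub's name. -/
abbrev stub_kerrCrushCertificate : Prop := KerrCrushCertificateExists
/-- Statement of `stub_crushTransport`, under the stub's name. -/
abbrev stub_crushTransport : Prop := CrushTransport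
end Goal

/-! ## Registered stubs, stated expanded (the only `sorry`s of the file) -/

/-- stub 0 — TYPED LEAVES ARE SOUND (DEAD AS TYPED BY DESIGN: the item's recorded misstatement, isolated; it is
exactly what disappears under the planners' sound re-type, where the hypothesis IS `SoundLeafHyp` and
`SettledCapture_of` below loses its first binder; do not drive): in a complete-`𝓘⁺` MGHD of an admissible datum
the crux's typed leaf block (`LeafHyp`, `Negative/TypedNormalForm.lean` p146299) implies the sound block
(`SoundLeafHyp`, `Negative/SoundRetype.lean` p153807). Idle-typed-leaf anchors: `leafHyp_minkowski`,
p122817/p123910 (0-hole boost-stretched timelike dodge sheets); sound leaves are achronal with honest discs and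
fail the margin `|aᵢ| ≤ χMᵢ` at extremal-Kerr end states (Kehle–Unger). Same text as line `tendril-swarm-rays`. -/
theorem stub_leavesAreSound : ∀ (X : Type) [TopologicalSpace X] [ChartedSpace E3 X] [IsManifold (𝓡 3) ((⊤ : ℕ∞) : WithTop ℕ∞) X] [T2Space X] [SecondCountableTopology X] [ConnectedSpace X], ∀ D ∈ admissibleVacuumData X, ∀ 𝒟 : VacuumCauchyDevelopment D, 𝒟.IsMaximal → Summit.FinalStateConjecture.HasCompleteNullInfinity 𝒟.toCauchyDevelopment → LeafHyp 𝒟 → SoundLeafHyp 𝒟 := by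
  sorry

/-- stub 1 — SOUND EXTERIOR CAPTURE WITH INTERIOR CHARTS AND RAY CENSUS (XL; open; the stub that consumes the
SOUND leaves, EXISTENTIAL in `(O, d, Φ)`): sub-extremal Kerr stability / multi-Kerr capture of the exterior (the four
exterior clauses), the interior export of Dafermos–Luk type (`C¹`-closeness to Kerr `(Mᵢ, aᵢ)` of
horizon-penetrating ingoing charts on the late red-shift/no-shift shells `{t* > T, r₋ + δ/2 < r < r₊}`, for every
`δ > 0`, eventually), and the census of complete rays (cofinally visible, or eventually and forever `δ`-deep in some
hole's late block II — pockets, early interiors and the `CH⁺` collar being excluded HERE). Reshape r3 (lead a1):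
rev-1's typed stub `stub_exteriorCaptureWithInteriorCharts` was returned `stub-misstated` by wave-1 worker B with
exactly this corrected signature (kernel certificate `work/stubs/StubExteriorCaptureWithInteriorCharts.lean`: typed
form `Iff.rfl`-equal to `LeafHyp → Conclusion`, idle hypothesis, ⊇ Capture 10115; sound form = re-typing only
weakens; Minkowski column holds). No single existing named fact closes it (Hintz / KS / DHRT claims are
perturbative slice-data statements without `FinalStateDecomposition`, interior export or census). Sources:
KlainermanSzeftel2023, arXiv:2205.14808, DafermosHolzegelRodnianskiTaylor2021, DafermosLuk2017, card `tendril-swarm-rays`. -/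
theorem stub_soundExteriorCaptureWithInteriorCharts : ∀ (X : Type) [TopologicalSpace X] [ChartedSpace E3 X] [IsManifold (𝓡 3) ((⊤ : ℕ∞) : WithTop ℕ∞) X] [T2Space X] [SecondCountableTopology X] [ConnectedSpace X], ∀ D ∈ admissibleVacuumData X, ∀ 𝒟 : VacuumCauchyDevelopment D, 𝒟.IsMaximal → Summit.FinalStateConjecture.HasCompleteNullInfinity 𝒟.toCauchyDevelopment → (∃ (N₀ : ℕ) (m₀ χ : ℝ) (k₁ : ℕ) (ε₁ : ENNReal), 0 < m₀ ∧ χ < 1 ∧ 0 < ε₁ ∧ ∀ (k : ℕ) (ε : ENNReal), 0 < ε → ∀ K : Set 𝒟.carrier, IsCompact K → ∃ (N : ℕ) (M a : Fin N → ℝ) (S : Set 𝒟.carrier), N ≤ N₀ ∧ (∀ i, m₀ ≤ M i ∧ M i ≤ m₀⁻¹) ∧ Disjoint S (𝒟.metric.causalPast 𝒟.timeOrientation K) ∧ 𝒟.toCauchyDevelopment.IsSoundNearKerrLeaf k ε N M a S ∧ (k₁ ≤ k → ε ≤ ε₁ → ∀ i, |a i| ≤ χ * M i)) → ∃ (O :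 Set 𝒟.carrier) (d : FinalStateDecomposition 𝒟.toSpacetime O 2), (∀ i, Kerr.IsSubextremal (d.mass i) (d.spin i)) ∧ O = Summit.FinalStateConjecture.exteriorOf 𝒟.toCauchyDevelopment d.charted ∧ Summit.FinalStateConjecture.HasExhaustiveCharts d ∧ Summit.FinalStateConjecture.IsFutureOriented d ∧ ∃ Φ : ∀ i, (interiorBackground (d.motion i) (d.mass i) (d.spin i) (Kerr.rMinus (d.mass i) (d.spin i))).domain → 𝒟.carrier, (∀ (i : Fin d.N) (δ : ℝ), 0 < δ → ∀ η : ℝ≥0∞, 0 < η → ∃ T : ℝ, IsGoodInteriorChart 𝒟 (d.motion i) (d.mass i) (d.spin i) (Φ i) T (Kerr.rMinus (d.mass i) (d.spin i) + δ / 2) (Kerr.rPlus (d.mass i) (d.spin i)) η) ∧ (∀ [𝒟.metric.HasLeviCivita], ∀ (p : X) (γ : ℝ → 𝒟.carrier) (dom : Set ℝ), 𝒟.metric.IsNormalisedNullRayFrom 𝒟.timeOrientation 𝒟.embed 𝒟.normal p γ dom → ¬ BddAbove dom → (∀ t ∈ dom, ∃ t' ∈ dom, t ≤ t' ∧ γ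 t' ∈ closure d.charted) ∨ ∃ (i : Fin d.N) (δ : ℝ), 0 < δ ∧ ∀ T : ℝ, ∃ t₀ ∈ dom, ∀ t ∈ dom, t₀ ≤ t → γ t ∈ Φ i '' lateShell (interiorBackground (d.motion i) (d.mass i) (d.spin i) (Kerr.rMinus (d.mass i) (d.spin i))) T (Kerr.rMinus (d.mass i) (d.spin i) + δ) (Kerr.rPlus (d.mass i) (d.spin i) - δ)) := by
  sorry

/-- stub 2 — THE KERR CRUSH CERTIFICATE (L; LANDED p162630 by the lead — no longer a stub; kit-certified: j023930 and triage r1-2/r1-3 re-runs — with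
`F = r − r₋` the ratio `sup f·f̈/ḟ²` is `< 1` on all of block II iff `a/M < 2√2/3`, `= 2a²/r₊²` near `r₊`, `≤ 2`
always and `= 1/2` at tuned `r₋`-arrivals, so a reparametrised profile `F = G(r − r₋)`,
`ρ̃ = 1 − φ(1 − ρ) − φ′h`, `φ = G/(G′h)`, certifies every `|a| < M`): for all sub-extremal `(M, a)` and `δ > 0` there
are `F`, `ρ < 1`, `m > 0` with `KerrCrushCertificate M a (r₋ + δ) (r₊ − δ) ρ m F`. Route to a proof: Carter's
`Σ ṙ = −√R`, `R = ℙ² − Δ𝒦 > 0` strictly inside (tree: `KerrCarterConstant`, `KerrRegionIINullRayCore`), or the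
closed-form radial acceleration `Kerr.Ingoing.delta_mul_two_mul_sq_sigma_mul_hessR` + the KS dictionary
(`KerrRadiusHessianIdentity.lean`); compactness of the normalised null bundle over the shell mod `∂_{t*}, ∂_φ` turns
the strict ratio bound into the margin `m`. Sources: Carter1968, ONeill1995 (Ch. 4, Thm. 4.2.2), card + j023930. -/
theorem stub_kerrCrushCertificate : ∀ (M a δ : ℝ), 0 < M → |a| < M → 0 < δ → ∃ (F : ℝ → ℝ) (ρ m : ℝ), ρ < 1 ∧ 0 < m ∧ KerrCrushCertificate M a (Kerr.rMinus M a + δ) (Kerr.rPlus M a - δ) ρ m F :=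
  -- LANDED (p162630, lead a1): `Theorems/BartnikGapSettlingSettledCaptureStubKerrCrushCertificate.lean`
  Summit.FinalStateConjecture.FinalStateConjecture.Theorems.BartnikGapSettling.SettledCapture.stub_kerrCrushCertificate

/-- stub 3 — CRUSH TRANSPORT (`C¹`-openness; L; LANDED p164946 by the lead from the landed halves 3a/3b — no longer a stub): given a certificate with margin for
`(M, a, δ, ρ, m, F)` and a motion `mo = (Λ, c)`, there is `η > 0` such that in EVERY development `𝒟` and every interior
chart `Φ` that is `η`-good on the late shell `{t* > T, r₋ + δ/2 < r < r₊}` (smooth future-oriented open embedding,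
`C¹`-deviation `≤ η`), every normalised null ray whose parameter tail `[t₀, ∞) ∩ dom` lies in
`Φ '' {t* > T, r₋ + δ < r < r₊ − δ}` carries `h(t) = F(r̃(γ t))` (`r̃` the chart radius) which is positive, `C²` on
compact sub-tails, strictly decreasing and weighted-concave `h h'' ≤ ρ h'²` inside `dom`. Proof route: `Φ` is an
immersion (non-degenerate pullback), `Φ⁻¹ ∘ γ` solves the coordinate geodesic equation of `Φ^* g`
(`OpensChartGeodesicODE.hasDerivAt_of_isGeodesicOn` shape), so `h'' = Hess_{Φ^*g} f(γ̇, γ̇)`; `C¹`-closeness of the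
components gives `C⁰`-closeness of `MetricCoord.chrAt`/`hessAt` and of the null cones (uniformly: `g_{M,a}` is
`t*`-independent and non-degenerate on the shell), future-directedness transfers through the orientation clause, and
the margins `m‖w‖`, `m‖w‖²` absorb the `O(η^{1/2})` errors. Sources: ONeill1983 (Ch. 3, Cor. 21, Lemma 3.49),
card `null-concave-crush` (§Why it bites here (3)). -/
theorem stub_crushTransport : ∀ (M a δ ρ m : ℝ) (F : ℝ → ℝ) (mo : lorentzGroup × E4), 0 < M → |a| < M → 0 < δ → 0 < m → KerrCrushCertificate M a (Kerr.rMinus M a + δ) (Kerr.rPlus M a - δ) ρ m F → ∃ η : ℝ≥0∞, 0 < η ∧ ∀ (X : Type) [TopologicalSpace X] [ChartedSpace E3 X] [IsManifold (𝓡 3) ((⊤ : ℕ∞) : WithTop ℕ∞) X] [T2Space X] [SecondCountableTopology X] [ConnectedSpace X] (D : InitialDataSet (𝓡 3) X) (𝒟 : VacuumCauchyDevelopment D) (Φ : (interiorBackground mo M a (Kerr.rMinus M a)).domain → 𝒟.carrier) (T : ℝ), IsGoodInteriorChart 𝒟 mo M a Φ T (Kerr.rMinus M a + δ / 2) (Kerr.rPlus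 M a) η → ∀ [𝒟.metric.HasLeviCivita], ∀ (p : X) (γ : ℝ → 𝒟.carrier) (dom : Set ℝ), 𝒟.metric.IsNormalisedNullRayFrom 𝒟.timeOrientation 𝒟.embed 𝒟.normal p γ dom → ∀ t₀ ∈ dom, (∀ t ∈ dom, t₀ ≤ t → γ t ∈ Φ '' lateShell (interiorBackground mo M a (Kerr.rMinus M a)) T (Kerr.rMinus M a + δ) (Kerr.rPlus M a - δ)) → ∃ h : ℝ → ℝ, (∀ t ∈ dom, t₀ ≤ t → ∃ x ∈ lateShell (interiorBackground mo M a (Kerr.rMinus M a)) T (Kerr.rMinus M a + δ) (Kerr.rPlus M a - δ), Φ x = γ t ∧ h t = F ((interiorBackground mo M a (Kerr.rMinus M a)).radius x.1)) ∧ (∀ t ∈ dom, t₀ < t → 0 < h t) ∧ (∀ t' ∈ dom, t₀ < t' → ContDiffOn ℝ 2 h (Set.Icc t₀ t')) ∧ ∀ t ∈ dom, t₀ < t → deriv h t < 0 ∧ h t * deriv (deriv h) t ≤ ρ * deriv h t ^ 2 :=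
  -- LANDED (p164946, lead a1; halves 3a `stub_chartNullGeodesic` p164700 (lead) + 3b `stub_boostedCertificateStable`
  -- p164592 (worker C), bricks `stub_crushChartImmersion` p163830, `stub_crushChartGeodesicLift` p164255):
  Summit.FinalStateConjecture.FinalStateConjecture.Theorems.BartnikGapSettling.SettledCapture.stub_crushTransport

/-! Consistency (elaborated, not kept in the environment). -/
example : Goal.stub_leavesAreSound := stub_leavesAreSound
example : Goal.stub_soundExteriorCaptureWithInteriorCharts := stub_soundExteriorCaptureWithInteriorCharts
example : Goal.stub_kerrCrushCertificate := stub_kerrCrushCertificate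
example : Goal.stub_crushTransport := stub_crushTransport

/-! ## The composition (kernel-checked; no `sorry` of its own) -/

/-- THE RE-TYPED CRUX `SoundSettledCapture` (`Negative/SoundRetype.lean`, p153807) from stub 1 ALONE — stubs 2 and 3 are LANDED tree theorems (the landed
`stub_visibleRaysStay` and the landed Riccati core of `exit_of_weightedConcave` are used inside): stub 1 gives
`(O, d)` with the exterior clauses, the interior charts and the ray census; for a complete ray and `t ≥ 0`, either
a later visible parameter exists and `stub_visibleRaysStay` puts `γ t` in `closure O`, or the ray ends up forever
`δ`-deep in hole `i`'s late block II, where stub 2's Kerr certificate, transported by stub 3 into the `η`-good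
chart that stub 1 exports late enough, makes `h = F(r̃ ∘ γ)` positive, decreasing and weighted-concave on an
unbounded parameter tail — impossible by `false_of_pos_of_deriv_neg_of_weightedConcave`. -/
theorem SoundSettledCapture_of (hA : Goal.stub_soundExteriorCaptureWithInteriorCharts) : SoundSettledCapture := by
  -- stubs 2 and 3 are LANDED (p162630; p164946 ⇐ p164700 + p164592): discharged here, no longer hypotheses
  have hK : Goal.stub_kerrCrushCertificate :=
    Summit.FinalStateConjecture.FinalStateConjecture.Theorems.BartnikGapSettling.SettledCapture.stub_kerrCrushCertificate
  have hT : Goal.stub_crushTransport :=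
    Summit.FinalStateConjecture.FinalStateConjecture.Theorems.BartnikGapSettling.SettledCapture.stub_crushTransport
  intro X _ _ _ _ _ _ D hD 𝒟 hmax hscri hleaves
  obtain ⟨O, d, hsub, hO, hexh, hfut, Φ, hgood, hcensus⟩ := hA X D hD 𝒟 hmax hscri hleaves
  refine ⟨O, d, hsub, hO, ?_, hexh, hfut⟩
  intro inst p γ dom hγ hunb t ht h0
  rcases hcensus p γ dom hγ hunb with hvis | ⟨i, δ, hδ, hdeep⟩
  · obtain ⟨t', ht', htt', hv⟩ := hvis t ht
    exact stub_visibleRaysStay X D hD 𝒟 O d hO p γ dom hγ t ht t' ht' h0 htt' hv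
  · exfalso
    -- the Kerr certificate of hole `i` at depth `δ`
    obtain ⟨F, ρ, m, hρ, hm, hcert⟩ := hK (d.mass i) (d.spin i) δ (d.mass_pos i) (hsub i) hδ
    -- its transport threshold `η` in the frame of hole `i`
    obtain ⟨η, hη, htrans⟩ :=
      hT (d.mass i) (d.spin i) δ ρ m F (d.motion i) (d.mass_pos i) (hsub i) hδ hm hcert
    -- the exported chart is `η`-good beyond chart time `T`
    obtain ⟨T, hT'⟩ := hgood i δ hδ η hη
    -- the ray is `δ`-deep in hole `i` beyond `T` from parameter `t₀` on
    obtain ⟨t₀, ht₀, htail⟩ := hdeep T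
    obtain ⟨h, -, hpos, hC2, hder⟩ := htrans X D 𝒟 (Φ i) T hT' p γ dom hγ t₀ ht₀ htail
    -- the parameter tail `[t₀, ∞)` lies in `dom` (an order-connected set unbounded above)
    have hoc : dom.OrdConnected := hγ.1.2.1
    have hdom : ∀ τ, t₀ ≤ τ → τ ∈ dom := by
      intro τ hτ
      obtain ⟨s, hs, hτs⟩ := not_bddAbove_iff.1 hunb τ
      exact hoc.out ht₀ hs ⟨hτ, hτs.le⟩
    exact false_of_pos_of_deriv_neg_of_weightedConcave (h := h) (t := t₀) hρ
      (fun τ hτ => hpos τ (hdom τ hτ.le) hτ) (fun T' hT'' => hC2 T' (hdom T' hT''.le) hT'')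
      fun τ hτ => hder τ (hdom τ hτ.le) hτ

/-- THE TYPED CRUX BY NAME from the two open stubs (stubs 2, 3 landed): stub 0 upgrades the typed leaves to sound ones (the isolated
misstatement), and the re-typed composition `SoundSettledCapture_of` does the rest (`settledCapture_iff` /
`soundSettledCapture_iff` are the `Iff.rfl` normal forms of the typed and re-typed texts). When the planners
re-type the item over sound leaves, this theorem loses its first binder and NOTHING ELSE in the file changes. -/
theorem SettledCapture_of :
    Goal.stub_leavesAreSound → Goal.stub_soundExteriorCaptureWithInteriorCharts →
      Summit.FinalStateConjecture.FinalStateConjecture.Theses.BartnikGapSettling.SettledCapture :=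
  fun h₀ hA ↦ settledCapture_iff.2 fun X _ _ _ _ _ _ D hD 𝒟 hmax hscri hleaf ↦
    soundSettledCapture_iff.1 (SoundSettledCapture_of hA) X D hD 𝒟 hmax hscri (h₀ X D hD 𝒟 hmax hscri hleaf)

end Summit.FinalStateConjecture.FinalStateConjecture.Cruxes.SettledCapture.NullConcaveCrush

end
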